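import Summits.KontsevichZagierPeriods.KontsevichZagierPeriods.Theorems.HurwitzMicroSectorsNormalFormPrincipleM4SharedTools
import Summits.KontsevichZagierPeriods.KontsevichZagierPeriods.Theorems.HurwitzMicroSectorsNormalFormPrincipleM4BoxSubSimplex4
import Summits.KontsevichZagierPeriods.KontsevichZagierPeriods.Theorems.HurwitzMicroSectorsNormalFormPrincipleM3EbdBoxSubSimplex
import Summits.KontsevichZagierPeriods.KontsevichZagierPeriods.Theorems.HurwitzMicroSectorsNormalFormPrincipleM3EbdDualityAndSplits
import Summits.KontsevichZagierPeriods.KontsevichZagierPeriods.Theorems.HyperbolicBlochOffTetraSectorKernelStubAffineOrbit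
import Literature.NumberTheory.Transcendental.KZProductIdeal

/-!
# `NormalFormPrinciple` (stmt-KontsevichZagierPeriods-3869), line `SketchIdeator1` —
# leaf `stub_boxRigidity`, layer `M4` packages: the box-stuffle `P(c;aab) = [aaac] + [aabc] − [caac]`

Pure proof file (registered sub-goal `m4_rel_bstuffle13m` of stmt-KontsevichZagierPeriods-3869,
line `SketchIdeator1`, lead seat c9; layer `M4` packages of the dimension-four campaign of the
leaf `stub_boxRigidity`; `--supports` the crux). Letters on `(0,1)`: `a(u) = 1/u`,
`b(u) = 1/(1−u)`, `c(u) = 1/(1+u)`; words `[x y z w] = [Δ₄, x(t₀)y(t₁)z(t₂)w(t₃)]` on the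
decreasing open simplex `Δ₄ = {1 > t₀ > t₁ > t₂ > t₃ > 0}`, `[aab] = [Δ₃, a(t₀)a(t₁)b(t₂)]`
(`= ζ(3)`), and the logarithm interval `[c] = [(0,1), 1/(1+x₀)]` (`= log 2`). The row proved is

  `P(c;aab) − [aaac] − [aabc] + [caac] ∈ KZ.relations`,   `P(c;aab) = [[c].prod [aab]]`,

the quasi-shuffle (stuffle) `c ∗ aab = caac − aabc − aaac + (2 products read as boxes)` realised
as: stuffle = ONE integrand-additivity move on the PRODUCT BOX (a three-term partial fraction)
+ a coordinate permutation + cubical charts. Precisely: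

* `[aab] ≃ [□³, 1/(1 − y₀y₁y₂)]` by the cubical chart of `□³` (rule 2, `ebd_box_sub_simplex`),
  hence, in the product ideal of the calculus (`KZ.Equivalent.prod`),
  `P(c;aab) ≡ N := [c] × [□³, 1/(1 − y₀y₁y₂)]`, whose domain is the box `□⁴` and whose integrand
  is `1/((1 + x₀)(1 − x₁x₂x₃))`;
* on `□⁴`, with `v = x₁x₂x₃` and `Π = x₀x₁x₂x₃`, the partial fraction
  `1/((1 + x₀)(1 − v)) = 1/(1 + Π) − x₀/((1 + x₀)(1 + Π)) + v/((1 − v)(1 + Π))`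
  is ONE integrand-additivity move (rule 1b, `aff_orbit_of_sub_sum_zsmul_mem_relations`);
* the three terms are the pull-backs along the cubical chart
  `t = (x₀, x₀x₁, x₀x₁x₂, x₀x₁x₂x₃)` of `□⁴` onto `Δ₄` (Jacobian `x₀³x₁²x₂`; rule 2,
  `m4_box_sub_simplex4`) of `[aaac]`, of `[caac]`, and — after the cyclic coordinate permutation
  `(x₁, x₂, x₃, x₀)` (rule 2, `KZ.of_sub_of_reindex_mem_relations`) — of `[aabc]`.

Sources: M. Kontsevich, D. Zagier, *Periods* (2001), §1.1–1.2 (rules (1b), (2)), §4.1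
(products); M. E. Hoffman, *The algebra of multiple harmonic series*, J. Algebra 194 (1997)
(quasi-shuffle). No definitions are introduced.
-/

noncomputable section

open MeasureTheory Set
open Literature.NumberTheory.Transcendental Literature.NumberTheory.Transcendental.KZ
open Literature.ModelTheory.ExponentialFields (IsSemialgebraic)
open Summit.KontsevichZagierPeriods.HyperbolicBloch.OffTetraSectorKernel
  (aff_orbit_of_sub_sum_zsmul_mem_relations)

namespace Summit.KontsevichZagierPeriods.HurwitzMicroSectors.NormalFormPrinciple.PiBox.M3

/-! ## Elementary facts -/

/-- Non-vanishing facts on the open unit box `□⁴`. [folklore] -/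
theorem m4j_box_facts {x : Fin 4 → ℝ} (hx : ∀ i, x i ∈ Set.Ioo (0:ℝ) 1) :
    x 0 ≠ 0 ∧ x 1 ≠ 0 ∧ x 2 ≠ 0 ∧ 1 + x 0 ≠ 0 ∧ 1 - x 1 * x 2 * x 3 ≠ 0 ∧
      1 + x 0 * x 1 * x 2 * x 3 ≠ 0 := by
  have h0 := (hx 0).1
  have h1 := (hx 1).1
  have h2 := (hx 2).1
  have h3 := (hx 3).1
  have h123 : x 1 * x 2 * x 3 < 1 :=
    mul_lt_one_of_nonneg_of_lt_one_left (mul_pos h1 h2).le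
      (mul_lt_one_of_nonneg_of_lt_one_left h1.le (hx 1).2 (hx 2).2.le) (hx 3).2.le
  refine ⟨h0.ne', h1.ne', h2.ne', ?_, (sub_pos.2 h123).ne', ?_⟩
  · positivity
  · positivity

/-- **The stuffle as a partial fraction** (the instance `α = −1`, `β = 1` of the three-term
identity `1/((1 − αu)(1 − βv)) = …`, with the two side terms already split along
`1/((1+u)(1+p)) = 1/(1+p) − u/((1+u)(1+p))`, `1/((1−v)(1+p)) = 1/(1+p) + v/((1−v)(1+p))`):
`1/((1 + u)(1 − v)) = 1/(1 + p) − u/((1 + u)(1 + p)) + v/((1 − v)(1 + p))` for `p = uv`.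
[cite: Hoffman1997, §2] -/
theorem m4j_partialFraction {u v p : ℝ} (hu : 1 + u ≠ 0) (hv : 1 - v ≠ 0) (huv : 1 + p ≠ 0)
    (hp : p = u * v) :
    1 / (1 + u) * (1 / (1 - v)) =
      1 / (1 + p) - u / ((1 + u) * (1 + p)) + v / ((1 - v) * (1 + p)) := by
  subst hp
  rw [one_div_mul_one_div, div_sub_div _ _ huv (mul_ne_zero hu huv),
    div_add_div _ _ (mul_ne_zero huv (mul_ne_zero hu huv)) (mul_ne_zero hv huv),
    div_eq_div_iff (mul_ne_zero hu hv)
      (mul_ne_zero (mul_ne_zero huv (mul_ne_zero hu huv)) (mul_ne_zero hv huv))]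
  ring

/-! ## The product box -/

/-- **The product box `N = [c] × [□³, 1/(1 − y₀y₁y₂)]`.** There is a representation `N` on the
open unit box `□⁴` with integrand `1/(1 + x₀) · 1/(1 − x₁x₂x₃)` and
`[N] − [[c].prod [aab]] ∈ KZ.relations`: `N` is the Fubini product (`KZ.IntegralRep.prod`) of the
interval `[c]` with the `ζ(3)` box `[□³, 1/(1 − y₀y₁y₂)]` (`ebd3_exists_zetaThreeBox`), the latter
is ONE cubical chart `t = (y₀, y₀y₁, y₀y₁y₂)` away from `[aab]` (rule 2, `ebd_box_sub_simplex`,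
pull-back `a(y₀)a(y₀y₁)b(y₀y₁y₂)·y₀²y₁ = 1/(1 − y₀y₁y₂)`), and products of equivalent
representations are equivalent (`KZ.Equivalent.prod`, the product ideal).
[cite: KontsevichZagier2001, §1.2 rule (2), §4.1] -/
theorem m4j_exists_productBox (C1 : IntegralRep 1)
    (hC1d : C1.domain = {x | ∀ i, x i ∈ Set.Ioo (0:ℝ) 1})
    (hC1i : C1.integrand = fun x => 1 / (1 + x 0)) (AAB : IntegralRep 3)
    (hAABd : AAB.domain = {t | 0 < t 2 ∧ t 2 < t 1 ∧ t 1 < t 0 ∧ t 0 < 1})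
    (hAABi : AAB.integrand = fun t => 1 / t 0 * 1 / t 1 * (1 / (1 - t 2))) :
    ∃ N : IntegralRep 4, N.domain = {x | ∀ i, x i ∈ Set.Ioo (0:ℝ) 1} ∧
      (∀ x, N.integrand x = 1 / (1 + x 0) * (1 / (1 - x 1 * x 2 * x 3))) ∧
      of N - of (C1.prod AAB) ∈ relations := by
  obtain ⟨B3, hB3d, hB3i⟩ := ebd3_exists_zetaThreeBox
  -- rule (2): the cubical chart of `□³` onto `Δ₃`, `[B3] − [AAB]`
  have hB : Equivalent B3 AAB := by
    refine ebd_box_sub_simplex (fun t => 1 / t 0 * 1 / t 1 * (1 / (1 - t 2))) B3 AAB hB3d hAABd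
      (hAABi ▸ fun _ _ => rfl) fun x hx => ?_
    have hx' : ∀ i, x i ∈ Set.Ioo (0:ℝ) 1 := by rw [hB3d] at hx; exact hx
    have h0 : x 0 ≠ 0 := (hx' 0).1.ne'
    have h1 : x 1 ≠ 0 := (hx' 1).1.ne'
    have h012 : 1 - x 0 * x 1 * x 2 ≠ 0 := by
      have := mul_lt_one_of_nonneg_of_lt_one_left (mul_pos (hx' 0).1 (hx' 1).1).le
        (mul_lt_one_of_nonneg_of_lt_one_left (hx' 0).1.le (hx' 0).2 (hx' 1).2.le) (hx' 2).2.le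
      exact (sub_pos.2 this).ne'
    rw [hB3i]
    simp only [Matrix.cons_val_zero, Matrix.cons_val_one, Matrix.cons_val_two, Matrix.head_cons,
      Matrix.tail_cons]
    field_simp
  have hC : Equivalent C1 C1 := by
    show of C1 - of C1 ∈ relations
    rw [sub_self]
    exact relations.zero_mem
  -- the product domain is the box `□⁴`, the product integrand is the literal product
  have hNd : (C1.prod B3).domain = {x | ∀ i, x i ∈ Set.Ioo (0:ℝ) 1} := by
    ext z
    rw [IntegralRep.prod_domain C1 B3, IntegralRep.mem_prodDomain C1 B3, hC1d, hB3d]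
    simp only [mem_setOf_eq]
    constructor
    · rintro ⟨h1, h2⟩ i
      exact Fin.addCases (motive := fun i => z i ∈ Set.Ioo (0:ℝ) 1) (fun i => h1 i)
        (fun j => h2 j) i
    · intro h
      exact ⟨fun i => h _, fun j => h _⟩
  have hNi : ∀ x : Fin 4 → ℝ,
      (C1.prod B3).integrand x = 1 / (1 + x 0) * (1 / (1 - x 1 * x 2 * x 3)) := by
    intro x
    rw [IntegralRep.prod_integrand_eq C1 B3, IntegralRep.prodFun_apply C1 B3, hC1i, hB3i]
    rfl
  exact ⟨C1.prod B3, hNd, hNi, hC.prod hB⟩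

/-! ## The registered sub-goal -/

/-- **Stub `m4_rel_bstuffle13m` (registered sub-goal of stmt-KontsevichZagierPeriods-3869, line
`SketchIdeator1`, layer `M4` packages).** The box-stuffle `P(c;aab) = [aaac] + [aabc] − [caac]`:
for the interval `[c] = [(0,1), 1/(1+x₀)]`, any carrier `[aab]` on `Δ₃` and any carriers
`[aaac]`, `[aabc]`, `[caac]` on `Δ₄` with the displayed integrands,
`[[c].prod [aab]] − [aaac] − [aabc] + [caac] ∈ KZ.relations`. Chain of moves: the product box
`N = [□⁴, 1/((1+x₀)(1−x₁x₂x₃))] ≡ P(c;aab)` (`m4j_exists_productBox`: one cubical chart in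
dimension three, product ideal); ONE integrand-additivity move on `□⁴` (the partial fraction
`m4j_partialFraction`) splitting `N` into `[□⁴, 1/(1+Π)]`, minus the cubical pull-back of
`[caac]`, plus the cyclically permuted cubical pull-back of `[aabc]`; three cubical charts
(`m4_box_sub_simplex4`) and one coordinate permutation (`KZ.of_sub_of_reindex_mem_relations`).
[cite: KontsevichZagier2001, §1.2 rules (1), (2), §4.1] -/
theorem m4_rel_bstuffle13m :
    ∀ (C1 : IntegralRep 1), C1.domain = {x | ∀ i, x i ∈ Set.Ioo (0:ℝ) 1} → (C1.integrand = fun x => 1 / (1 + x 0)) →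
      ∀ (AAB : IntegralRep 3), AAB.domain = {t | 0 < t 2 ∧ t 2 < t 1 ∧ t 1 < t 0 ∧ t 0 < 1} → (AAB.integrand = fun t => 1 / t 0 * 1 / t 1 * (1 / (1 - t 2))) →
      ∀ (AAAC : IntegralRep 4), AAAC.domain = {t | 0 < t 3 ∧ t 3 < t 2 ∧ t 2 < t 1 ∧ t 1 < t 0 ∧ t 0 < 1} → (AAAC.integrand = fun t => 1 / t 0 * (1 / t 1) * (1 / t 2) * (1 / (1 + t 3))) →
      ∀ (AABC : IntegralRep 4), AABC.domain = {t | 0 < t 3 ∧ t 3 < t 2 ∧ t 2 < t 1 ∧ t 1 < t 0 ∧ t 0 < 1} → (AABC.integrand = fun t => 1 / t 0 * (1 / t 1) * (1 / (1 - t 2)) * (1 / (1 + t 3))) →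
      ∀ (CAAC : IntegralRep 4), CAAC.domain = {t | 0 < t 3 ∧ t 3 < t 2 ∧ t 2 < t 1 ∧ t 1 < t 0 ∧ t 0 < 1} → (CAAC.integrand = fun t => 1 / (1 + t 0) * (1 / t 1) * (1 / t 2) * (1 / (1 + t 3))) →
      of (C1.prod AAB) - of AAAC - of AABC + of CAAC ∈ relations := by
  intro C1 hC1d hC1i AAB hAABd hAABi AAAC hAAACd hAAACi AABC hAABCd hAABCi CAAC hCAACd hCAACi
  -- the product box `N = [□⁴, 1/((1 + x₀)(1 − x₁x₂x₃))] ≡ P(c;aab)`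
  obtain ⟨N, hNd, hNi, hP⟩ := m4j_exists_productBox C1 hC1d hC1i AAB hAABd hAABi
  -- the three box carriers: `T3 = [□⁴, 1/(1 + Π)]` and the cubical pull-backs `W1`, `W2` of
  -- `[caac]`, `[aabc]` (existence halves of `m4_box_sub_simplex4`)
  obtain ⟨T3, hT3d, hT3i⟩ := m4t_exists_plusBox4
  obtain ⟨W1, hW1d, hW1i⟩ := m4_box_sub_simplex4.2
    (fun t => 1 / (1 + t 0) * (1 / t 1) * (1 / t 2) * (1 / (1 + t 3))) CAAC hCAACd
    (hCAACi ▸ fun _ _ => rfl)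
  obtain ⟨W2, hW2d, hW2i⟩ := m4_box_sub_simplex4.2
    (fun t => 1 / t 0 * (1 / t 1) * (1 / (1 - t 2)) * (1 / (1 + t 3))) AABC hAABCd
    (hAABCi ▸ fun _ _ => rfl)
  -- the cyclic permutation `σ = (0 ↦ 1 ↦ 2 ↦ 3 ↦ 0)` putting the interval coordinate last
  obtain ⟨σ, h0, h1, h2, h3⟩ : ∃ σ : Fin 4 ≃ Fin 4, σ 0 = 1 ∧ σ 1 = 2 ∧ σ 2 = 3 ∧ σ 3 = 0 :=
    ⟨⟨![1, 2, 3, 0], ![3, 0, 1, 2], by decide, by decide⟩, rfl, rfl, rfl, rfl⟩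
  -- rule (2): the three cubical charts
  have c3 : of T3 - of AAAC ∈ relations := by
    refine m4_box_sub_simplex4.1 (fun t => 1 / t 0 * (1 / t 1) * (1 / t 2) * (1 / (1 + t 3)))
      T3 AAAC hT3d hAAACd (hAAACi ▸ fun _ _ => rfl) fun x hx => ?_
    rw [hT3d] at hx
    obtain ⟨hx0, hx1, hx2, -, -, hpi⟩ := m4j_box_facts hx
    simp only [hT3i, Matrix.cons_val_zero, Matrix.cons_val_one, Matrix.cons_val_two,
      Matrix.cons_val_three, Matrix.head_cons, Matrix.tail_cons]
    field_simp
  have c1 : of W1 - of CAAC ∈ relations :=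
    m4_box_sub_simplex4.1 (fun t => 1 / (1 + t 0) * (1 / t 1) * (1 / t 2) * (1 / (1 + t 3)))
      W1 CAAC hW1d hCAACd (hCAACi ▸ fun _ _ => rfl) (hW1i ▸ fun _ _ => rfl)
  have c2 : of W2 - of AABC ∈ relations :=
    m4_box_sub_simplex4.1 (fun t => 1 / t 0 * (1 / t 1) * (1 / (1 - t 2)) * (1 / (1 + t 3)))
      W2 AABC hW2d hAABCd (hAABCi ▸ fun _ _ => rfl) (hW2i ▸ fun _ _ => rfl)
  -- rule (2): the coordinate permutation of `W2`
  have hperm : of W2 - of (W2.reindex σ) ∈ relations := of_sub_of_reindex_mem_relations W2 σ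
  -- the literal integrands of `W1` and `W2.reindex σ` on the box
  have hW1f : ∀ x : Fin 4 → ℝ, (∀ i, x i ∈ Set.Ioo (0:ℝ) 1) →
      W1.integrand x = x 0 / ((1 + x 0) * (1 + x 0 * x 1 * x 2 * x 3)) := by
    intro x hx
    obtain ⟨hx0, hx1, hx2, hu, -, hpi⟩ := m4j_box_facts hx
    simp only [hW1i, Matrix.cons_val_zero, Matrix.cons_val_one, Matrix.cons_val_two,
      Matrix.cons_val_three, Matrix.head_cons, Matrix.tail_cons]
    field_simp
  have hW2σd : (W2.reindex σ).domain = N.domain := by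
    rw [IntegralRep.reindex_domain, hW2d, hNd]
    ext w
    simp only [mem_setOf_eq]
    exact ⟨fun h i => by simpa using h (σ.symm i), fun h i => h (σ i)⟩
  have hW2σi : ∀ x : Fin 4 → ℝ, (∀ i, x i ∈ Set.Ioo (0:ℝ) 1) →
      (W2.reindex σ).integrand x =
        x 1 * x 2 * x 3 / ((1 - x 1 * x 2 * x 3) * (1 + x 0 * x 1 * x 2 * x 3)) := by
    intro x hx
    obtain ⟨-, hx1, hx2, -, hv, hpi⟩ := m4j_box_facts hx
    simp only [IntegralRep.reindex_integrand, hW2i, h0, h1, h2, h3, Matrix.cons_val_zero,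
      Matrix.cons_val_one, Matrix.cons_val_two, Matrix.cons_val_three, Matrix.head_cons,
      Matrix.tail_cons]
    rw [show x 1 * x 2 * x 3 * x 0 = x 0 * x 1 * x 2 * x 3 by ring]
    field_simp
  -- rule (1b): the partial fraction on the product box
  have hsplit : of N - ((1:ℤ) • of T3 + (-1:ℤ) • of W1 + (1:ℤ) • of (W2.reindex σ)) ∈
      relations := by
    have h := aff_orbit_of_sub_sum_zsmul_mem_relations (Finset.univ : Finset (Fin 3))
      ![T3, W1, W2.reindex σ] ![1, -1, 1] N (fun i _ => by
        fin_cases i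
        · exact hT3d.trans hNd.symm
        · exact hW1d.trans hNd.symm
        · exact hW2σd) fun x hx => ?_
    · simpa [Fin.sum_univ_three] using h
    rw [hNd] at hx
    obtain ⟨-, -, -, hu, hv, hpi⟩ := m4j_box_facts hx
    simp only [Fin.sum_univ_three, Matrix.cons_val_zero, Matrix.cons_val_one, Matrix.cons_val_two,
      Matrix.head_cons, Matrix.tail_cons, hNi x, hT3i, hW1f x hx, hW2σi x hx]
    rw [m4j_partialFraction hu hv hpi (by ring)]
    push_cast
    ring
  -- bookkeeping
  have e : of (C1.prod AAB) - of AAAC - of AABC + of CAAC =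
      (of N - ((1:ℤ) • of T3 + (-1:ℤ) • of W1 + (1:ℤ) • of (W2.reindex σ)))
        - (of N - of (C1.prod AAB)) + (of T3 - of AAAC) - (of W1 - of CAAC)
        + (of W2 - of AABC) - (of W2 - of (W2.reindex σ)) := by
    simp only [one_smul, neg_smul]
    abel
  rw [e]
  exact relations.sub_mem (relations.add_mem (relations.sub_mem (relations.add_mem
    (relations.sub_mem hsplit hP) c3) c1) c2) hperm

end Summit.KontsevichZagierPeriods.HurwitzMicroSectors.NormalFormPrinciple.PiBox.M3
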